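import Summits.QuantumFields.BalabanUV.Beta.FP.PackedLegBlocks
import Summits.QuantumFields.BalabanUV.Beta.FP.RelInvPeriodisedOneShot
import Summits.QuantumFields.BalabanUV.Beta.FP.RelInvPeriodisedCombMinOp
import Summits.QuantumFields.BalabanUV.Beta.FP.RelInvPeriodisedCombRecord

/-!
# `BalabanUV.Beta.FP.PackedLegBlocksAtSlices` — road «FP» for binder row D1, ROUTE T, (T-INV) row AT THE (T-ID) ASSEMBLY's LEGS (TID § F.8 STEP 2, § F.10 (L2′);
# the OWNER d1-p3 g21's #27 `PackedLegBlocks` + #24 `KernelDoorLegCurrency`; leaf-05 g31 words W-leaf05-g31-2 (junction probes J2 ∕ J3) and X2 (probe J5)):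
# **THE PACKED LEGS OF THE ONE-SHOT SLICE AND OF THE COMB (III′) SLICE IN DISPLAYED WORDS, THEIR RIGHT-INVERSE SOCKETS, AND THE DOOR's TORUS KERNEL AGAINST THEM**

WHY.  The (T-ID) assembly reads the (STEP) door's three bordered systems through #24 `hessT_kernel_law_of_secondVar_law_graded` (right-inverse sockets
`hXN hXF hXG`, legs `X.submatrix e e`, `e = Sum.map id Sum.inl`) and #27 `packedLeg_kktInv` (the leg of a sliced system `kkt H [Q;τ]` in the four blocks
`Γ = flucCov`, `I∘inl = (minOp …).submatrix id inl`, `L∘inl`, `−S₁₁ = −(effForm …).toBlocks₁₁`).  This lineage's (T-INV) letters say what those four blocks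
ARE at the two slice types the road uses: the ONE-SHOT slice (`RelInvPeriodisedOneShot` §3, g30 — any lattice chart `(A, 𝕄)` with the five letters at scale
`bigRatio Lc n`, root `bigRoot Lc rs n`, finest torus `towerTorus Lc M n`, rows `bigP Lc M rs hrs n`) and the COMB (III′) slice (`RelInvPeriodisedCombMinOp ∕
…CombRecord`, g29 — the chart of record `(GcombSh Lc j, bhKStepSh d Lc (Dsh Lc) j)` at any level `j` on any box with `Lc ∣ M`, rows `combRowsT (ctr (d+1) Lc) Lc M`).
This file composes them ONCE so the assembly has, per leg, three named theorems and nothing to rewrite by hand: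
* `packedLeg_oneShot_eq ∕ packedLeg_comb_eq` — `((kkt H [Q;τ])⁻¹).submatrix e e = fromBlocks Γ♯ I♯ L♯ (−S♯)` with the four DISPLAYED `axEc·perF`-words
  (#27 §1 then the four block letters, left to right);
* `kkt_mul_inv_oneShot ∕ kkt_mul_inv_comb` — #24's right-inverse socket with `X := (kkt …)⁻¹` (`Matrix.mul_nonsing_inv` + the (INV) letters
  `torus_isUnit_det_kkt_oneShot_of_relInv ∕ torus_isUnit_det_kkt_combRows_comb`);
* `mixedVar_sliced_oneShot ∕ mixedVar_sliced_comb` — the door's torus kernel (#27 §2 `mixedVar_signTwist_sliced`) against the displayed blocks.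
[folklore] block bookkeeping BY NAME over OUR typed objects; no `def`, no `def … : Prop`, nothing cited, 0 sorry; 0 estimates.  What it is NOT: not the
chart letters `hA hMh hAt hMt hrel hmm hanti` of the composite's one-shot chart `(A_N, 𝕄_N)` (an2's (C1)∕(C2) — DISPLAYED binders here), not `hcoarse`
(the presentation of the coarse multipliers — displayed), not (L1), not the de-periodisation (#23 ∕ (P2″)).

HONEST DEPENDENCY (page 1, mandatory): continuum YM on T⁴ ⇐ BetaPertH ∧ nine spine estimates (0/9 proved); BetaPertH ⇐ (D1) ∧ (D4) ∧ CAP+tail;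
G-an2-4 gates asym, D1 and NE2/3/4.  HONEST FRAMING (cell contract, verbatim): «discharging `BetaPertH` makes Bałaban's UV stability UNCONDITIONAL —
a real constructive-QFT result; it is NOT the continuum limit and NOT the Clay problem.»  ABSOLUTE RULE (cell charter, verbatim): «No internally-minted
statement may enter as a cited fact. Every hypothesis is either kernel-proved in this package or a verbatim quotation of a PUBLISHED theorem with page
reference. The manuscript(s) under audit are NOT citable for their own disputed steps — they are the thing under adjudication; programme-internal
(2001/route/tribunal) claims are never citable.»  Nothing of Bałaban's asserted; 0∕4 row-D1 binders (hW, hR, D1Tel, D1Rep); NOT (J-a), NOT (T-ID), NOT SDF,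
NOT D1, NOT BetaPertH, NOT continuum, NOT Clay.  Provenance: D1 formalisation swarm, unit `b2b-balaban-beta-d1-formalise-leaf-05` gen 31, 2026-08-22;
on the road «FP» OWNER's located ask (W-leaf05-g31-2 offer).  No existing file touched.
-/

noncomputable section

open scoped BigOperators Matrix

namespace Summit.QuantumFields.BalabanUV.Beta.FP.PackedLegBlocksAtSlices

open Matrix
open Literature.Probability.LatticeModels (Torus.proj)
open Literature.MathematicalPhysics.QuantumFieldTheory.Balaban1983to89
open Literature.MathematicalPhysics.QuantumFieldTheory.Balaban1983to89.Beta
open Literature.MathematicalPhysics.QuantumFieldTheory.Balaban1983to89.Beta.Composition (kkt)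
open Literature.MathematicalPhysics.QuantumFieldTheory.Balaban1983to89.Beta.CompositionSingular (effForm flucCov minOp minOpL)
open B6Lemma24Torus (pbox)
open ExpKernelCalculus (MKer shiftK)
open AffineAveraging (Site box toSite)
open AveragingContoursRooted (ctr)
open OneStepResolventKernel (Fib)
open Summit.QuantumFields.BalabanUV.Beta.TameKernelCalculus (Spr)
open Summit.QuantumFields.BalabanUV.Beta.ChartConjugationRelative (RelInv)
open Summit.QuantumFields.BalabanUV.Beta.AxialDressingRooted (axEc)
open Summit.QuantumFields.BalabanUV.Beta.SymShiftedSpread (bhKStepSh)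
open Summit.QuantumFields.BalabanUV.Beta.DshAn1 (Dsh)
open Summit.QuantumFields.BalabanUV.Beta.CombChartStepJets (GcombSh)
open Summit.QuantumFields.BalabanUV.Beta.FP.SecondVarPolarisation (mixedVar)
open Summit.QuantumFields.BalabanUV.Beta.D1BFx.MixedVarPackedHess (hessT)
open Summit.QuantumFields.BalabanUV.Beta.FP.KernelPeriodisationFib (Idx perF)
open Summit.QuantumFields.BalabanUV.Beta.FP.TorusCombRows (Res combRowsT)
open Summit.QuantumFields.BalabanUV.Beta.FP.TorusCompositeObjects (towerTorus bigRatio bigRoot bigP NParam)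
open Summit.QuantumFields.BalabanUV.Beta.FP.PackedLegBlocks (packedLeg_kktInv mixedVar_signTwist_sliced)
open Summit.QuantumFields.BalabanUV.Beta.FP.RelInvPeriodisedOneShot (torus_isUnit_det_kkt_oneShot_of_relInv torus_flucCov_eq_oneShot_of_relInv
  torus_minOp_submatrix_inl_oneShot_of_relInv torus_minOpL_submatrix_inl_oneShot_of_relInv effForm_toBlocks₁₁_oneShot_of_relInv)
open Summit.QuantumFields.BalabanUV.Beta.FP.RelInvPeriodisedCombMinOp (torus_flucCov_eq_comb torus_minOp_submatrix_inl_comb torus_minOpL_submatrix_inl_comb)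
open Summit.QuantumFields.BalabanUV.Beta.FP.RelInvPeriodisedCombRecord (torus_isUnit_det_kkt_combRows_comb effForm_toBlocks₁₁_comb)

/-! ## §1 The ONE-SHOT slice of depth `n` (finest torus `towerTorus Lc M n`, scale `bigRatio Lc n`, root `bigRoot Lc rs n`, rows `bigP Lc M rs hrs n`) -/

section OneShot

variable {d : ℕ} (Lc : ℕ) [NeZero Lc] (M : Fin (d + 1) → ℕ) [∀ μ, NeZero (M μ)] (rs : ℕ → (Fin (d + 1) → ℕ))
  (hrs : ∀ k i, 0 ≤ toSite (rs k) i ∧ toSite (rs k) i < (Lc : ℤ)) (n : ℕ) {A Mh : MKer (d + 1) (Fib d)}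

set_option synthInstance.maxSize 1024 in
/-- [folklore] **THE ONE-SHOT LEG IN DISPLAYED WORDS**: for any lattice chart `(A, 𝕄)` with the five letters at scale `bigRatio Lc n` (DISPLAYED binders — an2's
composite chart) and any injective `inr`-valued coarse presentation `fμ` with `hcoarse`, the packed leg `((kkt H♯ [Q♯; bigP])⁻¹).submatrix e e`,
`H♯ := (perF T 𝕄)∘(ff,ff)`, `Q♯ := (perF T 𝕄).submatrix fμ (ff)`, `T = towerTorus Lc M n`, IS `fromBlocks Γ♯ I♯ L♯ (−S♯)` with
`Γ♯ = of (axEc·axEc·perF T A)`, `I♯ = of (axEc·perF T A (·, fμ ·))`, `L♯ = −of (axEc·perF T A (fμ ·, ·))`, `S♯ = (perF T A).submatrix fμ fμ`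
(#27 `packedLeg_kktInv`, then this lineage's four one-shot block letters left to right). -/
theorem packedLeg_oneShot_eq (hM : ∀ i, Lc ∣ M i) (hA : Spr A) (hMh : Spr Mh)
    (hAt : ∀ t : Fin (d + 1) → ℤ, shiftK ((bigRatio Lc n : ℤ) • t) A = A) (hMt : ∀ t : Fin (d + 1) → ℤ, shiftK ((bigRatio Lc n : ℤ) • t) Mh = Mh)
    (hrel : RelInv A Mh (axEc (bigRoot Lc rs n) (bigRatio Lc n)))
    (hmm : ∀ (x y : Fin (d + 1) → ℤ) (κ l : Fin (d + 1)), Mh x y (Sum.inr κ) (Sum.inr l) = 0)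
    (hanti : ∀ (x y : Fin (d + 1) → ℤ) (κ l : Fin (d + 1)), Mh x y (Sum.inl κ) (Sum.inr l) = -Mh y x (Sum.inr l) (Sum.inl κ))
    {μ : Type*} [Fintype μ] [DecidableEq μ] (fμ : μ → Idx (towerTorus Lc M n) (Fib d)) (hfμ : Function.Injective fμ)
    (hμ : ∀ a : μ, ∃ m : Fin (d + 1), (fμ a).2 = Sum.inr m)
    (hcoarse : ∀ (s : ↥(pbox (towerTorus Lc M n))) (m : Fin (d + 1)),
      ((s, Sum.inr m) : Idx (towerTorus Lc M n) (Fib d)) ∈ Set.range fμ ↔ Torus.proj (bigRatio Lc n) (s : Site (d + 1)) = 0) :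
    ((kkt ((perF (towerTorus Lc M n) Mh).submatrix (fun b : ↥(pbox (towerTorus Lc M n)) × Fin (d + 1) => ((b.1, Sum.inl b.2) : Idx (towerTorus Lc M n) (Fib d)))
          (fun b : ↥(pbox (towerTorus Lc M n)) × Fin (d + 1) => ((b.1, Sum.inl b.2) : Idx (towerTorus Lc M n) (Fib d))))
        (fromRows ((perF (towerTorus Lc M n) Mh).submatrix fμ
            (fun b : ↥(pbox (towerTorus Lc M n)) × Fin (d + 1) => ((b.1, Sum.inl b.2) : Idx (towerTorus Lc M n) (Fib d))))
          (bigP Lc M rs hrs n)))⁻¹).submatrix (Sum.map id Sum.inl) (Sum.map id Sum.inl)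
      = fromBlocks
          (Matrix.of fun (b b' : ↥(pbox (towerTorus Lc M n)) × Fin (d + 1)) =>
          axEc (bigRoot Lc rs n) (bigRatio Lc n) (b.1 : Site (d + 1)) (b.1 : Site (d + 1)) (Sum.inl b.2) (Sum.inl b.2)
            * (axEc (bigRoot Lc rs n) (bigRatio Lc n) (b'.1 : Site (d + 1)) (b'.1 : Site (d + 1)) (Sum.inl b'.2) (Sum.inl b'.2)
              * perF (towerTorus Lc M n) A (b.1, Sum.inl b.2) (b'.1, Sum.inl b'.2)))
          (Matrix.of fun (b : ↥(pbox (towerTorus Lc M n)) × Fin (d + 1)) (a : μ) =>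
          axEc (bigRoot Lc rs n) (bigRatio Lc n) (b.1 : Site (d + 1)) (b.1 : Site (d + 1)) (Sum.inl b.2) (Sum.inl b.2)
            * perF (towerTorus Lc M n) A (b.1, Sum.inl b.2) (fμ a))
          (-Matrix.of fun (a : μ) (b : ↥(pbox (towerTorus Lc M n)) × Fin (d + 1)) =>
          axEc (bigRoot Lc rs n) (bigRatio Lc n) (b.1 : Site (d + 1)) (b.1 : Site (d + 1)) (Sum.inl b.2) (Sum.inl b.2)
            * perF (towerTorus Lc M n) A (fμ a) (b.1, Sum.inl b.2))
          (-((perF (towerTorus Lc M n) A).submatrix fμ fμ)) := by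
  rw [packedLeg_kktInv,
    torus_flucCov_eq_oneShot_of_relInv Lc M rs hrs n hM hA hMh hAt hMt hrel hmm hanti fμ hfμ hμ hcoarse,
    torus_minOp_submatrix_inl_oneShot_of_relInv Lc M rs hrs n hM hA hMh hAt hMt hrel hmm hanti fμ hfμ hμ hcoarse,
    torus_minOpL_submatrix_inl_oneShot_of_relInv Lc M rs hrs n hM hA hMh hAt hMt hrel hmm hanti fμ hfμ hμ hcoarse,
    effForm_toBlocks₁₁_oneShot_of_relInv Lc M rs hrs n hM hA hMh hAt hMt hrel hmm hanti fμ hfμ hμ hcoarse]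

set_option synthInstance.maxSize 1024 in
/-- [folklore] **#24's RIGHT-INVERSE SOCKET AT THE ONE-SHOT LEG**, `X_N := (kkt H♯ [Q♯; bigP])⁻¹`: `kkt H♯ [Q♯; bigP] * X_N = 1`
(`Matrix.mul_nonsing_inv` + the one-shot (INV) letter `torus_isUnit_det_kkt_oneShot_of_relInv`). -/
theorem kkt_mul_inv_oneShot (hM : ∀ i, Lc ∣ M i) (hA : Spr A) (hMh : Spr Mh)
    (hAt : ∀ t : Fin (d + 1) → ℤ, shiftK ((bigRatio Lc n : ℤ) • t) A = A) (hMt : ∀ t : Fin (d + 1) → ℤ, shiftK ((bigRatio Lc n : ℤ) • t) Mh = Mh)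
    (hrel : RelInv A Mh (axEc (bigRoot Lc rs n) (bigRatio Lc n)))
    (hmm : ∀ (x y : Fin (d + 1) → ℤ) (κ l : Fin (d + 1)), Mh x y (Sum.inr κ) (Sum.inr l) = 0)
    (hanti : ∀ (x y : Fin (d + 1) → ℤ) (κ l : Fin (d + 1)), Mh x y (Sum.inl κ) (Sum.inr l) = -Mh y x (Sum.inr l) (Sum.inl κ))
    {μ : Type*} [Fintype μ] [DecidableEq μ] (fμ : μ → Idx (towerTorus Lc M n) (Fib d)) (hfμ : Function.Injective fμ)
    (hμ : ∀ a : μ, ∃ m : Fin (d + 1), (fμ a).2 = Sum.inr m)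
    (hcoarse : ∀ (s : ↥(pbox (towerTorus Lc M n))) (m : Fin (d + 1)),
      ((s, Sum.inr m) : Idx (towerTorus Lc M n) (Fib d)) ∈ Set.range fμ ↔ Torus.proj (bigRatio Lc n) (s : Site (d + 1)) = 0) :
    kkt ((perF (towerTorus Lc M n) Mh).submatrix (fun b : ↥(pbox (towerTorus Lc M n)) × Fin (d + 1) => ((b.1, Sum.inl b.2) : Idx (towerTorus Lc M n) (Fib d)))
          (fun b : ↥(pbox (towerTorus Lc M n)) × Fin (d + 1) => ((b.1, Sum.inl b.2) : Idx (towerTorus Lc M n) (Fib d))))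
        (fromRows ((perF (towerTorus Lc M n) Mh).submatrix fμ
            (fun b : ↥(pbox (towerTorus Lc M n)) × Fin (d + 1) => ((b.1, Sum.inl b.2) : Idx (towerTorus Lc M n) (Fib d))))
          (bigP Lc M rs hrs n))
        * (kkt ((perF (towerTorus Lc M n) Mh).submatrix (fun b : ↥(pbox (towerTorus Lc M n)) × Fin (d + 1) => ((b.1, Sum.inl b.2) : Idx (towerTorus Lc M n) (Fib d)))
          (fun b : ↥(pbox (towerTorus Lc M n)) × Fin (d + 1) => ((b.1, Sum.inl b.2) : Idx (towerTorus Lc M n) (Fib d))))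
            (fromRows ((perF (towerTorus Lc M n) Mh).submatrix fμ
            (fun b : ↥(pbox (towerTorus Lc M n)) × Fin (d + 1) => ((b.1, Sum.inl b.2) : Idx (towerTorus Lc M n) (Fib d))))
              (bigP Lc M rs hrs n)))⁻¹ = 1 :=
  Matrix.mul_nonsing_inv _ (torus_isUnit_det_kkt_oneShot_of_relInv Lc M rs hrs n hM hA hMh hAt hMt hrel hmm hanti fμ hfμ hμ hcoarse)

set_option synthInstance.maxSize 1024 in
/-- [folklore] **THE DOOR's TORUS KERNEL AGAINST THE ONE-SHOT LEG's DISPLAYED BLOCKS**: #27 §2 `mixedVar_signTwist_sliced` at the one-shot slice types, the four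
blocks rewritten by the one-shot block letters — for graded first jets `[[K_a, −[Q_a;0]ᵀ],[[Q_a;0],0]]`, `[[K_b,…]]` and second jet `kkt K_ab [Q_ab;0]`,
`mixedVar (kkt H♯ [Q♯; bigP]) J_a J_b J_ab = 2·hessT (fromBlocks Γ♯ I♯ L♯ (−S♯)) [[K_a,−Q_aᵀ],[Q_a,0]] [[K_b,−Q_bᵀ],[Q_b,0]] (kkt K_ab Q_ab)`. -/
theorem mixedVar_sliced_oneShot (hM : ∀ i, Lc ∣ M i) (hA : Spr A) (hMh : Spr Mh)
    (hAt : ∀ t : Fin (d + 1) → ℤ, shiftK ((bigRatio Lc n : ℤ) • t) A = A) (hMt : ∀ t : Fin (d + 1) → ℤ, shiftK ((bigRatio Lc n : ℤ) • t) Mh = Mh)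
    (hrel : RelInv A Mh (axEc (bigRoot Lc rs n) (bigRatio Lc n)))
    (hmm : ∀ (x y : Fin (d + 1) → ℤ) (κ l : Fin (d + 1)), Mh x y (Sum.inr κ) (Sum.inr l) = 0)
    (hanti : ∀ (x y : Fin (d + 1) → ℤ) (κ l : Fin (d + 1)), Mh x y (Sum.inl κ) (Sum.inr l) = -Mh y x (Sum.inr l) (Sum.inl κ))
    {μ : Type*} [Fintype μ] [DecidableEq μ] (fμ : μ → Idx (towerTorus Lc M n) (Fib d)) (hfμ : Function.Injective fμ)
    (hμ : ∀ a : μ, ∃ m : Fin (d + 1), (fμ a).2 = Sum.inr m)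
    (hcoarse : ∀ (s : ↥(pbox (towerTorus Lc M n))) (m : Fin (d + 1)),
      ((s, Sum.inr m) : Idx (towerTorus Lc M n) (Fib d)) ∈ Set.range fμ ↔ Torus.proj (bigRatio Lc n) (s : Site (d + 1)) = 0)
    (Ka Kb Kab : Matrix (↥(pbox (towerTorus Lc M n)) × Fin (d + 1)) (↥(pbox (towerTorus Lc M n)) × Fin (d + 1)) ℝ)
    (Qa Qb Qab : Matrix μ (↥(pbox (towerTorus Lc M n)) × Fin (d + 1)) ℝ) :
    mixedVar (kkt ((perF (towerTorus Lc M n) Mh).submatrix (fun b : ↥(pbox (towerTorus Lc M n)) × Fin (d + 1) => ((b.1, Sum.inl b.2) : Idx (towerTorus Lc M n) (Fib d)))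
          (fun b : ↥(pbox (towerTorus Lc M n)) × Fin (d + 1) => ((b.1, Sum.inl b.2) : Idx (towerTorus Lc M n) (Fib d))))
        (fromRows ((perF (towerTorus Lc M n) Mh).submatrix fμ
            (fun b : ↥(pbox (towerTorus Lc M n)) × Fin (d + 1) => ((b.1, Sum.inl b.2) : Idx (towerTorus Lc M n) (Fib d))))
          (bigP Lc M rs hrs n)))
        (fromBlocks Ka (-(fromRows Qa (0 : Matrix (NParam Lc M rs n) _ ℝ))ᵀ) (fromRows Qa (0 : Matrix (NParam Lc M rs n) _ ℝ)) 0)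
        (fromBlocks Kb (-(fromRows Qb (0 : Matrix (NParam Lc M rs n) _ ℝ))ᵀ) (fromRows Qb (0 : Matrix (NParam Lc M rs n) _ ℝ)) 0)
        (kkt Kab (fromRows Qab (0 : Matrix (NParam Lc M rs n) _ ℝ)))
      = 2 * hessT (fromBlocks
            (Matrix.of fun (b b' : ↥(pbox (towerTorus Lc M n)) × Fin (d + 1)) =>
          axEc (bigRoot Lc rs n) (bigRatio Lc n) (b.1 : Site (d + 1)) (b.1 : Site (d + 1)) (Sum.inl b.2) (Sum.inl b.2)
            * (axEc (bigRoot Lc rs n) (bigRatio Lc n) (b'.1 : Site (d + 1)) (b'.1 : Site (d + 1)) (Sum.inl b'.2) (Sum.inl b'.2)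
              * perF (towerTorus Lc M n) A (b.1, Sum.inl b.2) (b'.1, Sum.inl b'.2)))
            (Matrix.of fun (b : ↥(pbox (towerTorus Lc M n)) × Fin (d + 1)) (a : μ) =>
          axEc (bigRoot Lc rs n) (bigRatio Lc n) (b.1 : Site (d + 1)) (b.1 : Site (d + 1)) (Sum.inl b.2) (Sum.inl b.2)
            * perF (towerTorus Lc M n) A (b.1, Sum.inl b.2) (fμ a))
            (-Matrix.of fun (a : μ) (b : ↥(pbox (towerTorus Lc M n)) × Fin (d + 1)) =>
          axEc (bigRoot Lc rs n) (bigRatio Lc n) (b.1 : Site (d + 1)) (b.1 : Site (d + 1)) (Sum.inl b.2) (Sum.inl b.2)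
            * perF (towerTorus Lc M n) A (fμ a) (b.1, Sum.inl b.2))
            (-((perF (towerTorus Lc M n) A).submatrix fμ fμ)))
          (fromBlocks Ka (-Qaᵀ) Qa 0) (fromBlocks Kb (-Qbᵀ) Qb 0) (kkt Kab Qab) := by
  rw [mixedVar_signTwist_sliced,
    torus_flucCov_eq_oneShot_of_relInv Lc M rs hrs n hM hA hMh hAt hMt hrel hmm hanti fμ hfμ hμ hcoarse,
    torus_minOp_submatrix_inl_oneShot_of_relInv Lc M rs hrs n hM hA hMh hAt hMt hrel hmm hanti fμ hfμ hμ hcoarse,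
    torus_minOpL_submatrix_inl_oneShot_of_relInv Lc M rs hrs n hM hA hMh hAt hMt hrel hmm hanti fμ hfμ hμ hcoarse,
    effForm_toBlocks₁₁_oneShot_of_relInv Lc M rs hrs n hM hA hMh hAt hMt hrel hmm hanti fμ hfμ hμ hcoarse]

end OneShot

/-! ## §2 The COMB (III′) slice at level `j` (chart of record `(GcombSh Lc j, bhKStepSh d Lc (Dsh Lc) j)`, any box `M` with `Lc ∣ M`, rows `combRowsT (ctr (d+1) Lc) Lc M`) -/

section Comb

variable {d : ℕ} {Lc : ℕ} [NeZero Lc] (M : Fin (d + 1) → ℕ) [∀ μ, NeZero (M μ)]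

set_option synthInstance.maxSize 1024 in
/-- [folklore] **THE COMB LEG IN DISPLAYED WORDS** (fine ∕ coarse systems of the door at the chart of record): `((kkt H [Q; τ])⁻¹).submatrix e e
= fromBlocks Γ I′ L′ (−S₁₁)` with `Γ = of (axEc·axEc·perF M (GcombSh Lc j))`, `I′ = of (axEc·perF M (GcombSh Lc j) (·, fμ ·))`, `L′ = −of (…)`,
`S₁₁ = (perF M (GcombSh Lc j)).submatrix fμ fμ` (#27 §1, then this lineage's four comb block letters). -/
theorem packedLeg_comb_eq (hM : ∀ i, Lc ∣ M i) (j : ℕ)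
    {μ : Type*} [Fintype μ] [DecidableEq μ] (fμ : μ → Idx M (Fib d)) (hfμ : Function.Injective fμ)
    (hμ : ∀ a : μ, ∃ m : Fin (d + 1), (fμ a).2 = Sum.inr m)
    (hcoarse : ∀ (s : ↥(pbox M)) (m : Fin (d + 1)), ((s, Sum.inr m) : Idx M (Fib d)) ∈ Set.range fμ ↔ Torus.proj Lc (s : Site (d + 1)) = 0) :
    ((kkt ((perF M (bhKStepSh d Lc (Dsh Lc) j)).submatrix (fun b : ↥(pbox M) × Fin (d + 1) => ((b.1, Sum.inl b.2) : Idx M (Fib d)))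
          (fun b : ↥(pbox M) × Fin (d + 1) => ((b.1, Sum.inl b.2) : Idx M (Fib d))))
        (fromRows ((perF M (bhKStepSh d Lc (Dsh Lc) j)).submatrix fμ (fun b : ↥(pbox M) × Fin (d + 1) => ((b.1, Sum.inl b.2) : Idx M (Fib d))))
          ((combRowsT (ctr (d + 1) Lc) Lc M).submatrix id (fun b : ↥(pbox M) × Fin (d + 1) => ((b.1, Sum.inl b.2) : Idx M (Fib d))))))⁻¹).submatrix (Sum.map id Sum.inl) (Sum.map id Sum.inl)
      = fromBlocks
          (Matrix.of fun (b b' : ↥(pbox M) × Fin (d + 1)) =>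
          axEc (ctr (d + 1) Lc) Lc (b.1 : Site (d + 1)) (b.1 : Site (d + 1)) (Sum.inl b.2) (Sum.inl b.2)
            * (axEc (ctr (d + 1) Lc) Lc (b'.1 : Site (d + 1)) (b'.1 : Site (d + 1)) (Sum.inl b'.2) (Sum.inl b'.2)
              * perF M (GcombSh (d := d) Lc j) (b.1, Sum.inl b.2) (b'.1, Sum.inl b'.2)))
          (Matrix.of fun (b : ↥(pbox M) × Fin (d + 1)) (a : μ) =>
          axEc (ctr (d + 1) Lc) Lc (b.1 : Site (d + 1)) (b.1 : Site (d + 1)) (Sum.inl b.2) (Sum.inl b.2)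
            * perF M (GcombSh (d := d) Lc j) (b.1, Sum.inl b.2) (fμ a))
          (-Matrix.of fun (a : μ) (b : ↥(pbox M) × Fin (d + 1)) =>
          axEc (ctr (d + 1) Lc) Lc (b.1 : Site (d + 1)) (b.1 : Site (d + 1)) (Sum.inl b.2) (Sum.inl b.2)
            * perF M (GcombSh (d := d) Lc j) (fμ a) (b.1, Sum.inl b.2))
          (-((perF M (GcombSh (d := d) Lc j)).submatrix fμ fμ)) := by
  rw [packedLeg_kktInv,
    torus_flucCov_eq_comb M hM j fμ hfμ hμ hcoarse, torus_minOp_submatrix_inl_comb M hM j fμ hfμ hμ hcoarse,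
    torus_minOpL_submatrix_inl_comb M hM j fμ hfμ hμ hcoarse, effForm_toBlocks₁₁_comb M hM j fμ hfμ hμ hcoarse]

set_option synthInstance.maxSize 1024 in
/-- [folklore] **#24's RIGHT-INVERSE SOCKET AT THE COMB LEG**, `X := (kkt H [Q; τ])⁻¹` (`Matrix.mul_nonsing_inv` + `torus_isUnit_det_kkt_combRows_comb`). -/
theorem kkt_mul_inv_comb (hM : ∀ i, Lc ∣ M i) (j : ℕ)
    {μ : Type*} [Fintype μ] [DecidableEq μ] (fμ : μ → Idx M (Fib d)) (hfμ : Function.Injective fμ)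
    (hμ : ∀ a : μ, ∃ m : Fin (d + 1), (fμ a).2 = Sum.inr m)
    (hcoarse : ∀ (s : ↥(pbox M)) (m : Fin (d + 1)), ((s, Sum.inr m) : Idx M (Fib d)) ∈ Set.range fμ ↔ Torus.proj Lc (s : Site (d + 1)) = 0) :
    kkt ((perF M (bhKStepSh d Lc (Dsh Lc) j)).submatrix (fun b : ↥(pbox M) × Fin (d + 1) => ((b.1, Sum.inl b.2) : Idx M (Fib d)))
          (fun b : ↥(pbox M) × Fin (d + 1) => ((b.1, Sum.inl b.2) : Idx M (Fib d))))
        (fromRows ((perF M (bhKStepSh d Lc (Dsh Lc) j)).submatrix fμ (fun b : ↥(pbox M) × Fin (d + 1) => ((b.1, Sum.inl b.2) : Idx M (Fib d))))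
          ((combRowsT (ctr (d + 1) Lc) Lc M).submatrix id (fun b : ↥(pbox M) × Fin (d + 1) => ((b.1, Sum.inl b.2) : Idx M (Fib d)))))
        * (kkt ((perF M (bhKStepSh d Lc (Dsh Lc) j)).submatrix (fun b : ↥(pbox M) × Fin (d + 1) => ((b.1, Sum.inl b.2) : Idx M (Fib d)))
          (fun b : ↥(pbox M) × Fin (d + 1) => ((b.1, Sum.inl b.2) : Idx M (Fib d))))
            (fromRows ((perF M (bhKStepSh d Lc (Dsh Lc) j)).submatrix fμ (fun b : ↥(pbox M) × Fin (d + 1) => ((b.1, Sum.inl b.2) : Idx M (Fib d))))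
              ((combRowsT (ctr (d + 1) Lc) Lc M).submatrix id (fun b : ↥(pbox M) × Fin (d + 1) => ((b.1, Sum.inl b.2) : Idx M (Fib d))))))⁻¹ = 1 :=
  Matrix.mul_nonsing_inv _ (torus_isUnit_det_kkt_combRows_comb M hM j fμ hfμ hμ hcoarse)

set_option synthInstance.maxSize 1024 in
/-- [folklore] **THE DOOR's TORUS KERNEL AGAINST THE COMB LEG's DISPLAYED BLOCKS** (#27 §2 at the comb slice types, then the four comb block letters). -/
theorem mixedVar_sliced_comb (hM : ∀ i, Lc ∣ M i) (j : ℕ)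
    {μ : Type*} [Fintype μ] [DecidableEq μ] (fμ : μ → Idx M (Fib d)) (hfμ : Function.Injective fμ)
    (hμ : ∀ a : μ, ∃ m : Fin (d + 1), (fμ a).2 = Sum.inr m)
    (hcoarse : ∀ (s : ↥(pbox M)) (m : Fin (d + 1)), ((s, Sum.inr m) : Idx M (Fib d)) ∈ Set.range fμ ↔ Torus.proj Lc (s : Site (d + 1)) = 0)
    (Ka Kb Kab : Matrix (↥(pbox M) × Fin (d + 1)) (↥(pbox M) × Fin (d + 1)) ℝ) (Qa Qb Qab : Matrix μ (↥(pbox M) × Fin (d + 1)) ℝ) :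
    mixedVar (kkt ((perF M (bhKStepSh d Lc (Dsh Lc) j)).submatrix (fun b : ↥(pbox M) × Fin (d + 1) => ((b.1, Sum.inl b.2) : Idx M (Fib d)))
          (fun b : ↥(pbox M) × Fin (d + 1) => ((b.1, Sum.inl b.2) : Idx M (Fib d))))
        (fromRows ((perF M (bhKStepSh d Lc (Dsh Lc) j)).submatrix fμ (fun b : ↥(pbox M) × Fin (d + 1) => ((b.1, Sum.inl b.2) : Idx M (Fib d))))
          ((combRowsT (ctr (d + 1) Lc) Lc M).submatrix id (fun b : ↥(pbox M) × Fin (d + 1) => ((b.1, Sum.inl b.2) : Idx M (Fib d))))))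
        (fromBlocks Ka (-(fromRows Qa (0 : Matrix (Res (ctr (d + 1) Lc) Lc M) _ ℝ))ᵀ) (fromRows Qa (0 : Matrix (Res (ctr (d + 1) Lc) Lc M) _ ℝ)) 0)
        (fromBlocks Kb (-(fromRows Qb (0 : Matrix (Res (ctr (d + 1) Lc) Lc M) _ ℝ))ᵀ) (fromRows Qb (0 : Matrix (Res (ctr (d + 1) Lc) Lc M) _ ℝ)) 0)
        (kkt Kab (fromRows Qab (0 : Matrix (Res (ctr (d + 1) Lc) Lc M) _ ℝ)))
      = 2 * hessT (fromBlocks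
            (Matrix.of fun (b b' : ↥(pbox M) × Fin (d + 1)) =>
          axEc (ctr (d + 1) Lc) Lc (b.1 : Site (d + 1)) (b.1 : Site (d + 1)) (Sum.inl b.2) (Sum.inl b.2)
            * (axEc (ctr (d + 1) Lc) Lc (b'.1 : Site (d + 1)) (b'.1 : Site (d + 1)) (Sum.inl b'.2) (Sum.inl b'.2)
              * perF M (GcombSh (d := d) Lc j) (b.1, Sum.inl b.2) (b'.1, Sum.inl b'.2)))
            (Matrix.of fun (b : ↥(pbox M) × Fin (d + 1)) (a : μ) =>
          axEc (ctr (d + 1) Lc) Lc (b.1 : Site (d + 1)) (b.1 : Site (d + 1)) (Sum.inl b.2) (Sum.inl b.2)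
            * perF M (GcombSh (d := d) Lc j) (b.1, Sum.inl b.2) (fμ a))
            (-Matrix.of fun (a : μ) (b : ↥(pbox M) × Fin (d + 1)) =>
          axEc (ctr (d + 1) Lc) Lc (b.1 : Site (d + 1)) (b.1 : Site (d + 1)) (Sum.inl b.2) (Sum.inl b.2)
            * perF M (GcombSh (d := d) Lc j) (fμ a) (b.1, Sum.inl b.2))
            (-((perF M (GcombSh (d := d) Lc j)).submatrix fμ fμ)))
          (fromBlocks Ka (-Qaᵀ) Qa 0) (fromBlocks Kb (-Qbᵀ) Qb 0) (kkt Kab Qab) := by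
  rw [mixedVar_signTwist_sliced,
    torus_flucCov_eq_comb M hM j fμ hfμ hμ hcoarse, torus_minOp_submatrix_inl_comb M hM j fμ hfμ hμ hcoarse,
    torus_minOpL_submatrix_inl_comb M hM j fμ hfμ hμ hcoarse, effForm_toBlocks₁₁_comb M hM j fμ hfμ hμ hcoarse]

end Comb

end Summit.QuantumFields.BalabanUV.Beta.FP.PackedLegBlocksAtSlices

end
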